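import Summits.AtomisticToContinuum.HydrodynamicLimit.Theses.JParityClosure
import Summits.AtomisticToContinuum.HydrodynamicLimit.Theses.LimitCollisionMeasure
import Summits.AtomisticToContinuum.HydrodynamicLimit.Theorems.JParityClosureEvenStressEnskogRung0LocalStatistics
import Summits.AtomisticToContinuum.HydrodynamicLimit.Theorems.JParityClosureEvenStressEnskogOneBodyDeviationRung0
import Summits.AtomisticToContinuum.HydrodynamicLimit.Theorems.JParityClosureEvenStressEnskogVelocityEquilibrationRung0
import Summits.AtomisticToContinuum.HydrodynamicLimit.Theorems.JParityClosureEvenStressEnskogKineticSlavingDiracLimit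
import Summits.AtomisticToContinuum.HydrodynamicLimit.Theorems.JParityClosureEvenStressEnskogFreeCollisionalBalanceKN
import Summits.AtomisticToContinuum.HydrodynamicLimit.Theorems.JParityClosureEvenStressEnskogDiagonalParityRigidityReduction
import Literature.MathematicalPhysics.KineticTheory.EvenCollisionTubeFunctional
import Literature.MathematicalPhysics.KineticTheory.MicroscaleWindowFunctionals
import Literature.MathematicalPhysics.KineticTheory.EvenStatTruncationBound
import Summits.AtomisticToContinuum.HydrodynamicLimit.Theorems.JParityClosureEvenStressEnskogLocalGibbsReduction
import Summits.AtomisticToContinuum.HydrodynamicLimit.Theorems.EvenStressEnskog.Negative.SwappedOrderTrivial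
import Summits.AtomisticToContinuum.HydrodynamicLimit.Theorems.EvenStressEnskog.Negative.TwoStreamTexture
import Summits.AtomisticToContinuum.HydrodynamicLimit.Theorems.JParityClosureEvenStressEnskogQuadraticTestConvergence
-- import Summits.AtomisticToContinuum.HydrodynamicLimit.Theorems.JParityClosureEvenStressEnskogRung0Sides  -- LANDED p140225; re-import when the farm has built it (see §4b)
import Summits.AtomisticToContinuum.HydrodynamicLimit.Theorems.JParityClosureEvenStressEnskogValueFree
import Summits.AtomisticToContinuum.HydrodynamicLimit.Theorems.JParityClosureEvenStressEnskogPreShockGlue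
import Summits.AtomisticToContinuum.HydrodynamicLimit.Theorems.JParityClosureEvenStressEnskogPreShockConverse
import Summits.AtomisticToContinuum.HydrodynamicLimit.Theorems.JParityClosureEvenStressEnskogPreShockRung0Frame

/-!
# Line `preshock-kinetic-slaving` for crux `JParityClosure.EvenStressEnskog` (stmt-AtomisticToContinuum-13079)
# — crux-strategist WALL-BREAKER line (planner-cstrat-stmt-AtomisticToContinuum-13079-p1-0, 2026-08-17)
# — lead c7 (prover-line-stmt-AtomisticToContinuum-13079-c7-0) reshape v1, 2026-08-17: S3 split into the registered
#   S3a `stub_quadraticTestConvergence` (tool, M) · S3b `stub_velocityEquilibrationRung0` (rung 0, L) · S3c `stub_kineticSlavingOfTools` (XL)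
# — lead c7 reshape v2, 2026-08-17 (wave 2): S3a LANDED (p140362); S3b split into the registered
#   S3b1 `stub_rung0LocalStatistics` (statics at a point, M–L) · S3b2 `stub_oneBodyDeviationRung0` (pointwise `L¹` deviation, L) ·
#   S3b3 `stub_velocityEquilibrationRung0_of_deviation` (Tonelli–DCT–flow-invariance–Markov assembly, L); S3b itself is DERIVED.
#   Registered stubs (7 = stubs_max): S1 S2 S3b1 S3b2 S3b3 S3c S4.
# — lead c7 reshape v3, 2026-08-17 (after wave 2): S3b1/S3b2/S3b3 LANDED (p144623 / p146349 / p149013) ⇒ S3b CLOSED (derived,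
#   sorry-free below); S3c audited `stub-misstated` (worker S3c, `KineticSlavingAudit.md`): the lever needs the a-priori inputs
#   `KineticAprioriPreShock := LimitCollisionMeasure.CollisionTightness (stmt-13354, by name) ∧ MesoscaleCompactnessPreShock` (new);
#   S3c ↦ S3c-a `stub_freeCollisionalBalanceKN` (M) · S3c-b `stub_diagonalParityRigidity` (L) · S3c-c `stub_kineticCoreOfTools` (XL);
#   S4 ↦ S45 `stub_kineticInputs : KineticHalf ∧ KineticAprioriPreShock` (by citation).  Registered stubs (7): S1 S2 S3c-a S3c-b S3c-c S45
#   + (none else; S3a, S3b1–3 archived as landed).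
# — lead c7 reshape v4, 2026-08-17 (after wave 3): S3c-a LANDED (p151581); S3c-b reduced by the worker to the diagonal COLLISION INVARIANCE
#   `stub_diagonalCollisionInvariance` (ML; LANDED reduction p152253 `stub_diagonalParityRigidity_of_ae_map_collide_eq`, + p152891 defect,
#   p153152 energy, p154051 identification) ⇒ S3c-b DERIVED.  Registered stubs (5): S1 S2 S3c-b' stub_diagonalCollisionInvariance ·
#   S3c-c stub_kineticCoreOfTools · S45 stub_kineticInputs.

## The idea in one paragraph

Eight line leads, two triage panels and the standing disprover agree on the diagnosis of the exhausted chain: every open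
stub of the five dead lines (`stub_meanEnskog`, `stub_universalContactLaw` (U), `stub_arrivalChaos`, `stub_isoChaos`,
`stub_defectHierarchyUniqueness`) is ONE missing input — in-probability control of the deterministic hard-sphere flow at
POSITIVE times at fixed reduced density — dressed five ways, and each of them carries it for BOTH halves of the crux (the
two-body contact law AND the one-body `r`-scale Maxwellianity) and for ALL `τ` (post-blow-up included).  This line does
not bet on a sixth costume.  It CUTS the crux along the two seams the chain itself exposed, so that what is open is
(a) minimal, (b) correctly framed, and (c) shared with the rest of the route instead of paid for twice:

* **seam 1 — the FRAME** (`stub_frameGap : EvenStressEnskogPreShock → EvenStressEnskog`).  The filed decl quantifies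
  `∀ τ > 0` over ALL local-Gibbs evolutions with no Euler solution and no `t = 0` LLN tie, while its only consumers
  (`ParityInBand`, `ParityBandClosure`, hence `closes`) use `τ < T` instances tied to a classical solution (lead c6,
  `RestatePreShock.lean`; Disproof §6.5(5), §12; TRIAGE-r1 route-level remark; LINES-RULING-c5 rec. 2).  The `∀ τ` surplus
  is post-singularity MESOSCALE COMPACTNESS of the empirical velocity field (Disproof §12, `Negative/TwoStreamTexture`:
  a K41-type "no energy pile-up between `λ_N` and `o(1)`" statement) plus the crux for rough continuous data that admit
  no classical solution at all.  Nobody needs it; the stub names it, so that the tenure planner's restatement R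
  (`route edit --restate EvenStressEnskog` to the pre-shock frame, implication `EvenStressEnskog → EvenStressEnskogPreShock`
  PROVED below as `preShock_of_crux`) turns it into `id` and the rest of the line stands unchanged.
* **seam 2 — ONE-BODY vs TWO-BODY** (the landed `evenStressEnskog_of_sides` / `contactPredM_sub_enskog_eq_oneBodyPred_sub_
  oneBodyStat`, p134979 / p134407, re-threaded here in the pre-shock frame, sorry-free): pre-shock, the crux is the
  CONTACT SIDE for its six even marks (`stub_contactEvenPreShock`, the two-body core — Disproof §6.3's "TRUE iff local
  equilibrium propagates in the two-body contact channel", now without the §12 amendment because `τ < T`) plus the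
  ENSKOG SIDE, which is EXACTLY the one-body statement (L1) for the weight `g·Ỹ·a` and the six quadratic test functions
  `F_{kl}` (kinetic-stress isotropy at scale `r`).
* **the lever — KINETIC SLAVING** (`stub_kineticSlaving : KineticHalf → VelocityEquilibrationPreShock`): pre-shock (L1) is
  NOT a second open problem of this crux — it is the designed OUTPUT of the route's own kinetic half (route header,
  TWO-LAYER PLAN: `ParityInBand ⇐ OddToEquilibration (cruxes 2, 4 + three proved supports → LocalVelocityEquilibration) →
  EquilibriumToBand`; ParityInBand docstring steps (i)–(ii)): OddContactSymmetry (γ̄_a = 0 on the flux support) +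
  EmpiricalEnskogIdentity (PROVED: free collisional balance) + RateFloor + ParityRigidity (PROVED: vanishing even production
  ⇒ point mass or Maxwellian) + KineticEnergyTails (UI of `|v|²`, pre-shock) + CollisionTightness (tightness of `K_N`) give,
  along subsequences, Maxwellian-or-Dirac Young-measure limits of the `r`-mollified one-body law with convergent second
  moments — and a Dirac or a Maxwellian has the second moments of the Maxwellian with ITS OWN mean and trace temperature,
  which is all (L1) asks (the `r`-ball MIXTURE of local laws is what the `r`-mollified production functional of
  OddContactSymmetry controls, so sub-`r` velocity texture is excluded pre-shock by the same token).  This stub is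
  PROVABLE mathematics (XL soft analysis: random Young measures, passage of the proved parity identities to the limit,
  rigidity, uniform integrability) — the first stub of this crux since rung 0 that a prover can close — and its proof is
  verbatim the kinetic two-thirds of the glue `ParityInBand` (stmt-13088) / crux 7 `ParityBandClosure` (stmt-17608), so it
  is paid ONCE for the route (land it as `Theorems/JParityClosureLocalVelocityEquilibration.lean --supports stmt-13079`, cite
  it from 13088/17608).
* `stub_kineticHalf : KineticHalf` is NOT a target of this line: it is the conjunction, BY NAME, of the route items
  OddContactSymmetry (17722), RateFloor (13080), LocalSecondLaw (13081), DensityCap (13082), CollisionTightness (13085),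
  KineticEnergyTails (13087) — all of them hypotheses of `closes` or supports under crux 7's umbrella — and closes by
  citation when they close (a stub-worker answers `blocked-on: stmt-17722` correctly).  It is in the skeleton only because
  a line must conclude the crux from its stubs alone; the honest logical structure of the configurational crux IS
  "two-body core + kinetic half", and hiding the kinetic half inside an `ArrivalChaos`/`IsoChaos`/`(UQ)` bet (which implies
  BOTH halves) is what made lines 1–3 strictly more open than necessary (TRIAGE-r1-3 doubt (1) on defect-hierarchy, made
  explicit and turned into bookkeeping here).

Composition (kernel-checked, sorry-free): `EvenStressEnskog_of h1 h2 h3 h4 := h1 (evenStressEnskogPreShock_of_sides h2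
(enskogSidePreShock_of_velocityEquilibration (h3 h4)))`.

## What is open after this line, honestly
Exactly `stub_contactEvenPreShock` (two-body local equilibrium in the J-even momentum channel, pre-shock, data-tied: the
open core of the hydrodynamic limit in its configurational half — `[difficulty: open-problem]`, as the crux itself) and the
sibling kinetic items.  `stub_frameGap` is open mathematics ONLY if the route insists on the `∀ τ` frame it never uses.

## Disproof.lean used (cycles 1–2; no `_false_without_<H>` theorem exists for this crux; `-- Targets` touch no stub here)
§6.2/§6.3 (shape of any refutation; "TRUE iff two-body LE propagates" — `stub_contactEvenPreShock` is that statement and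
nothing more); §6.5(5) + §12 + `Negative/TwoStreamTexture` (`pairFunctionalP_two_stream`: the `∀ τ` surplus is mesoscale
compactness — isolated in `stub_frameGap`, absent from every other stub because they are `τ < T`); §8 (the trace of
`stub_contactEvenPreShock` is the pre-shock impulse-rate law — predicted, not fought); §9 `Negative/SwappedOrderTrivial`
(limit ORDER `r` fixed while `N → ∞` in every statement here; `r` never depends on `N`); §10–§11 (second-moment blindness
of the Enskog side = why the Enskog side is one-body: the engine of `enskogSidePreShock_of_velocityEquilibration`); §3/§5
(`contactValue` only under `ρ_r²·g`, analytic clamp `Ỹ` via `exists_contactValue_clamp`, `η₀ := min η₀^{(L1)} η_Y`).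

## Dead lines avoided (at the step that died)
even-rung (`stub_meanEnskog` = crux in mean ∀τ incl. texture) / liouville (`(U)` ⇔ crux) — no value-free or in-mean
restatement here; stationary-microscale (`stub_arrivalChaos` ∀τ, implies both halves) / rotate-fly (`stub_isoChaos`) /
defect-hierarchy (`(UQ)` + local-limit reduction) — no off-contact chaos, isotropy or uniqueness bet: the one-body half is
routed to the kinetic cruxes that the route must prove anyway, the two-body half is left as the named core, pre-shock;
c5 F1 (no fixed-`r` transfer) — no transfer stub; c5 F2 (Lagrangian weights need ImpulseTightness) — all functionals here
are the Eulerian tree functionals `collisionSum / contactPredM / enskogRate / oneBodyStat / oneBodyPred`.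
-/

set_option linter.unusedVariables false

noncomputable section

namespace Summit.AtomisticToContinuum.HydrodynamicLimit.Cruxes.EvenStressEnskog.PreshockKineticSlaving

open scoped BigOperators InnerProductSpace Topology ENNReal Classical
open MeasureTheory Filter Set
open Literature.MathematicalPhysics.KineticTheory Literature.Analysis.FluidPDE
open Literature.MathematicalPhysics.KineticTheory.StationaryMicroscale
open Summit.AtomisticToContinuum.HydrodynamicLimit.Theses.JParityClosure
open Summit.AtomisticToContinuum.HydrodynamicLimit.Theorems.EvenStressEnskog

/-! ## §1 Named statements -/

/-- **The crux in the PRE-SHOCK, DATA-TIED frame** (lead c6's `Restate.EvenStressEnskogPreShock`, here with the crux's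
`let`-chain named by the tree's `evenStat` / `evenMark` — definitionally the same bodies, cf. `evenStressEnskog_iff` of
Disproof §1 / line 1): the filed body verbatim, but after `σ < σ₀` it quantifies over a classical hard-sphere Euler solution
`(ρ,u,θ)` on `[0,T)`, over flow families whose local-Gibbs fields satisfy the `t = 0` LLN towards it, and restricts the horizon
to `0 < τ < T` — literally the frame of the sibling crux `OddContactSymmetry` (rev 5) and of the support `KineticEnergyTails`,
and exactly the instances `ParityInBand` / `ParityBandClosure` consume. [folklore] -/
def EvenStressEnskogPreShock : Prop :=
  ∃ η₀ : ℝ, 0 < η₀ ∧ ∀ (a₀ θ₀ : T3 → ℝ) (u₀ : T3 → V3), Continuous a₀ → Continuous θ₀ → Continuous u₀ →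
    (∀ x, 0 < a₀ x) → (∀ x, 0 < θ₀ x) → ∃ σ₀ : ℝ, 0 < σ₀ ∧ ∀ σ : ℝ, 0 < σ → σ < σ₀ →
    ∀ (T : ℝ) (ρ θ : ℝ → T3 → ℝ) (u : ℝ → T3 → V3), IsHardSphereEulerSolution σ T ρ u θ →
    ∀ Φ : (N : ℕ) → HardSphereFlow (Torus.geometry (Fin 3)) (hsDiameter σ N) (N + 1),
    TendstoHydroFieldsAt (fun N => localGibbsLaw σ a₀ u₀ θ₀ N (Φ N)) Φ ρ u θ 0 →
    ∀ τ : ℝ, 0 < τ → τ < T →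
    ∀ χ : ℝ × T3 → ℝ, Continuous χ → ∀ g : ℝ → ℝ, Continuous g → (∀ a, η₀ ≤ a → g a = 0) →
    ∀ η δ : ℝ, 0 < η → 0 < δ → ∃ r₀ : ℝ, 0 < r₀ ∧ ∀ r : ℝ, 0 < r → r < r₀ → ∃ N₀ : ℕ, ∀ N : ℕ, N₀ ≤ N →
    ∀ k l : Fin 3,
      localGibbsLaw σ a₀ u₀ θ₀ N (Φ N) {z | η < |evenStat σ N (Φ N) τ χ g (evenMark k l) r z|} ≤ ENNReal.ofReal δ

/-- **CONTACT SIDE, PRE-SHOCK, EVEN MARKS** — the two-body core of the crux, correctly framed: along forward local-Gibbs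
evolutions tied to a classical hs-Euler solution on `[0,T)` by the `t = 0` LLN, for `τ < T`, the collision sum of the J-even
momentum-transfer marks `Ξ_P^{kl} = evenMark k l` weighted by `χ g(σ³ρ_r)` is `η`-close in probability to the FULLY MAXWELLIAN
Enskog prediction `contactPredM` (thermodynamic contact value `Y(σ³ρ_r)`, Maxwellian velocities at the `r`-ball parameters
`(ρ_r, u_r, θ_r)`), `N → ∞` at fixed `r`, then `r → 0`.  Limit content: the pre-collisional contact pair law, in the Ξ_P-channel,
is `Y(η(t,x)) ρ² M⊗M` — propagation of two-body local equilibrium at contact, pre-shock (Disproof §6.3).  Hypothesis `hC` of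
the landed `evenStressEnskog_of_sides` restricted to the pre-shock frame. [folklore] -/
def ContactEvenPreShock : Prop :=
  ∃ η₀ : ℝ, 0 < η₀ ∧ ∀ (a₀ θ₀ : T3 → ℝ) (u₀ : T3 → V3), Continuous a₀ → Continuous θ₀ → Continuous u₀ →
    (∀ x, 0 < a₀ x) → (∀ x, 0 < θ₀ x) → ∃ σ₀ : ℝ, 0 < σ₀ ∧ ∀ σ : ℝ, 0 < σ → σ < σ₀ →
    ∀ (T : ℝ) (ρ θ : ℝ → T3 → ℝ) (u : ℝ → T3 → V3), IsHardSphereEulerSolution σ T ρ u θ →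
    ∀ Φ : (N : ℕ) → HardSphereFlow (Torus.geometry (Fin 3)) (hsDiameter σ N) (N + 1),
    TendstoHydroFieldsAt (fun N => localGibbsLaw σ a₀ u₀ θ₀ N (Φ N)) Φ ρ u θ 0 →
    ∀ τ : ℝ, 0 < τ → τ < T →
    ∀ χ : ℝ × T3 → ℝ, Continuous χ → ∀ g : ℝ → ℝ, Continuous g → (∀ a, η₀ ≤ a → g a = 0) →
    ∀ k l : Fin 3,
    ∀ η δ : ℝ, 0 < η → 0 < δ → ∃ r₀ : ℝ, 0 < r₀ ∧ ∀ r : ℝ, 0 < r → r < r₀ → ∃ N₀ : ℕ, ∀ N : ℕ, N₀ ≤ N →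
      localGibbsLaw σ a₀ u₀ θ₀ N (Φ N)
        {z | η < |collisionSum σ N (Φ N) τ χ g (evenMark k l) r z - contactPredM σ N (Φ N) τ χ g (evenMark k l) r z|}
        ≤ ENNReal.ofReal δ

/-- **ENSKOG SIDE, PRE-SHOCK, EVEN MARKS** — the fully Maxwellian prediction `contactPredM` is `η`-close to the crux's own
empirical Enskog term `σ³ ∫₀^τ enskogRate ∘ Φ_s ds` (h-blind `B_r`), pre-shock frame.  Content: isotropy of the `r`-ball
kinetic stress (Disproof §10–§11); NOT a stub — derived below from (L1)-pre-shock by the landed exact identity. [folklore] -/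
def EnskogSidePreShock : Prop :=
  ∃ η₀ : ℝ, 0 < η₀ ∧ ∀ (a₀ θ₀ : T3 → ℝ) (u₀ : T3 → V3), Continuous a₀ → Continuous θ₀ → Continuous u₀ →
    (∀ x, 0 < a₀ x) → (∀ x, 0 < θ₀ x) → ∃ σ₀ : ℝ, 0 < σ₀ ∧ ∀ σ : ℝ, 0 < σ → σ < σ₀ →
    ∀ (T : ℝ) (ρ θ : ℝ → T3 → ℝ) (u : ℝ → T3 → V3), IsHardSphereEulerSolution σ T ρ u θ →
    ∀ Φ : (N : ℕ) → HardSphereFlow (Torus.geometry (Fin 3)) (hsDiameter σ N) (N + 1),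
    TendstoHydroFieldsAt (fun N => localGibbsLaw σ a₀ u₀ θ₀ N (Φ N)) Φ ρ u θ 0 →
    ∀ τ : ℝ, 0 < τ → τ < T →
    ∀ χ : ℝ × T3 → ℝ, Continuous χ → ∀ g : ℝ → ℝ, Continuous g → (∀ a, η₀ ≤ a → g a = 0) →
    ∀ k l : Fin 3,
    ∀ η δ : ℝ, 0 < η → 0 < δ → ∃ r₀ : ℝ, 0 < r₀ ∧ ∀ r : ℝ, 0 < r → r < r₀ → ∃ N₀ : ℕ, ∀ N : ℕ, N₀ ≤ N →
      localGibbsLaw σ a₀ u₀ θ₀ N (Φ N)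
        {z | η < |contactPredM σ N (Φ N) τ χ g (evenMark k l) r z
              - σ ^ 3 * ∫ s in Set.Icc (0 : ℝ) τ, enskogRate σ N χ g (evenMark k l) r s ((Φ N).flow s z)|}
        ≤ ENNReal.ofReal δ

/-- **VELOCITY EQUILIBRATION, PRE-SHOCK** = (L1) `OneBodyMaxwellTested` of line 1 in the pre-shock, data-tied frame: the
`r`-ball empirical velocity law, tested against continuous `F(v, u, θ)` of second-moment growth read at its OWN parameters
`(u_r, θ_r)`, is `η`-close in probability to the Maxwellian prediction, `N → ∞` at fixed `r`, then `r → 0`, for `τ < T`.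
The second-moment-tested, Eulerian form of the route's foreseen node `LocalVelocityEquilibration` (route header, TWO-LAYER
PLAN) — the OUTPUT of the kinetic half. [folklore] -/
def VelocityEquilibrationPreShock : Prop :=
  ∃ η₀ : ℝ, 0 < η₀ ∧ ∀ (a₀ θ₀ : T3 → ℝ) (u₀ : T3 → V3), Continuous a₀ → Continuous θ₀ → Continuous u₀ →
    (∀ x, 0 < a₀ x) → (∀ x, 0 < θ₀ x) → ∃ σ₀ : ℝ, 0 < σ₀ ∧ ∀ σ : ℝ, 0 < σ → σ < σ₀ →
    ∀ (T : ℝ) (ρ θ : ℝ → T3 → ℝ) (u : ℝ → T3 → V3), IsHardSphereEulerSolution σ T ρ u θ →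
    ∀ Φ : (N : ℕ) → HardSphereFlow (Torus.geometry (Fin 3)) (hsDiameter σ N) (N + 1),
    TendstoHydroFieldsAt (fun N => localGibbsLaw σ a₀ u₀ θ₀ N (Φ N)) Φ ρ u θ 0 →
    ∀ τ : ℝ, 0 < τ → τ < T →
    ∀ χ : ℝ × T3 → ℝ, Continuous χ → ∀ k : ℝ → ℝ, Continuous k → (∀ a, η₀ ≤ a → k a = 0) →
    ∀ F : V3 × V3 × ℝ → ℝ, Continuous F →
    (∃ C : ℝ, ∀ q, |F q| ≤ C * (1 + ‖q.1‖ ^ 2 + ‖q.2.1‖ ^ 2 + |q.2.2|)) →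
    ∀ η δ : ℝ, 0 < η → 0 < δ → ∃ r₀ : ℝ, 0 < r₀ ∧ ∀ r : ℝ, 0 < r → r < r₀ → ∃ N₀ : ℕ, ∀ N : ℕ, N₀ ≤ N →
      localGibbsLaw σ a₀ u₀ θ₀ N (Φ N)
        {z | η < |oneBodyStat σ N (Φ N) τ χ k F r z - oneBodyPred σ N (Φ N) τ χ k F r z|}
        ≤ ENNReal.ofReal δ

/-- **THE KINETIC HALF OF THE ROUTE, BY NAME** — the conjunction of the route items `OddContactSymmetry` (stmt-17722, crux 2),
`RateFloor` (13080, crux 4), `LocalSecondLaw` (13081, crux 5), `DensityCap` (13082, crux 6), `CollisionTightness` (13085,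
support) and `KineticEnergyTails` (13087, support): every one a hypothesis of `closes` or an open support under crux 7's
umbrella.  NOT a target of this line (see `Stubs.stub_kineticHalf`). [folklore] -/
def KineticHalf : Prop :=
  OddContactSymmetry ∧ RateFloor ∧ LocalSecondLaw ∧ DensityCap ∧ CollisionTightness ∧ KineticEnergyTails

/-- **MESOSCALE COMPACTNESS OF THE WINDOW LAWS, PRE-SHOCK** — a-priori input (C) of the corrected lever (worker S3c audit h6,
lead c7 reshape v3; text verbatim from `KineticSlavingPlan.lean` §2).  In the pre-shock tied frame, for every bounded continuous
velocity test `φ`, the `r`-window statistic `W^{N,r}_φ(s,x) = ∫ b_r(y,x) φ(v) dμ_{Φ_s z}` has an `L¹(ds dx)` space–time modulus of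
continuity in probability UNIFORM IN `r < r₀` (Kolmogorov–Riesz ⇒ trivial Young fibres along the diagonal `N → ∞, r → 0`).  NOT
supplied by any conjunct of `KineticHalf` (all fixed-test / time-integrated / one-time); physically first-order-in-Kn local
equilibrium information (pre-shock the fields are smooth); it is what defeats the two-fibre counter-models that killed the sister
crux's line (`Cruxes/ParityBandClosure/Lines/SketchDead.md` §2–§3, toy kernel-checked p141493).  NO BOARD ITEM YET (planner: file it,
or re-type 17722/13080 per the audit's alternatives R-a/R-b). [folklore] -/
def MesoscaleCompactnessPreShock : Prop :=
  ∀ (a₀ θ₀ : T3 → ℝ) (u₀ : T3 → V3), Continuous a₀ → Continuous θ₀ → Continuous u₀ →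
    (∀ x, 0 < a₀ x) → (∀ x, 0 < θ₀ x) → ∃ σ₀ : ℝ, 0 < σ₀ ∧ ∀ σ : ℝ, 0 < σ → σ < σ₀ →
    ∀ (T : ℝ) (ρ θ : ℝ → T3 → ℝ) (u : ℝ → T3 → V3), IsHardSphereEulerSolution σ T ρ u θ →
    ∀ Φ : (N : ℕ) → HardSphereFlow (Torus.geometry (Fin 3)) (hsDiameter σ N) (N + 1),
    TendstoHydroFieldsAt (fun N => localGibbsLaw σ a₀ u₀ θ₀ N (Φ N)) Φ ρ u θ 0 →
    ∀ τ : ℝ, 0 < τ → τ < T →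
    ∀ φ : V3 → ℝ, Continuous φ → (∃ C : ℝ, ∀ v, |φ v| ≤ C) →
    ∀ η δ : ℝ, 0 < η → 0 < δ → ∃ l₀ : ℝ, 0 < l₀ ∧ ∃ r₀ : ℝ, 0 < r₀ ∧
    ∀ r : ℝ, 0 < r → r < r₀ → ∀ l : ℝ, 0 < l → l < l₀ → ∀ y : T3, dist y 0 < l₀ → ∃ N₀ : ℕ, ∀ N : ℕ, N₀ ≤ N →
      localGibbsLaw σ a₀ u₀ θ₀ N (Φ N)
        {z | ENNReal.ofReal η < ∫⁻ s in Set.Icc (0 : ℝ) τ, ∫⁻ x : T3, ENNReal.ofReal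
              |(∫ q, coneKernel r q.1 (x + y) * φ q.2 ∂(empiricalMeasure ((Φ N).flow (s + l) z))) -
                (∫ q, coneKernel r q.1 x * φ q.2 ∂(empiricalMeasure ((Φ N).flow s z)))|} ≤ ENNReal.ofReal δ

/-- **THE A-PRIORI KINETIC INPUTS OF THE LEVER, BY NAME** — (A) velocity-moment tightness of the empirical collision measure =
the board item stmt-AtomisticToContinuum-13354 `LimitCollisionMeasure.CollisionTightness` BY NAME (audit h4: needed to pass the free
balance to the limit and to admit the quadratic-growth surprisal marks; `JParityClosure.CollisionTightness` is mass-only,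
`KineticEnergyTails` a one-time average), and (C) `MesoscaleCompactnessPreShock` (audit h6). [folklore] -/
def KineticAprioriPreShock : Prop :=
  Summit.AtomisticToContinuum.HydrodynamicLimit.Theses.LimitCollisionMeasure.CollisionTightness ∧ MesoscaleCompactnessPreShock

/-- **FREE COLLISIONAL BALANCE IN `K_N` UNITS** (conclusion of S3c-a; pathwise, deterministic; text verbatim from
`KineticSlavingPlan.lean` I₂): for a `C¹` time weight `a`, a smooth space weight `b` and ANY bounded velocity observable `c`, the
collision sum of the balance mark `(n, v⁻, w⁻) ↦ c(v⁺) − c(v⁻)` is `O(ε_N)` on every good orbit whose initial instant is not a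
collision time: `|K_N[a b Δc]| ≤ ε_N · C(a,b,‖c‖,τ) · (1 + mean kinetic energy)` — `empiricalEnskogIdentity_proof` (PROVED) times `ε`,
the free-transport side bounded by `‖a‖_{C¹}‖b‖_{C¹}‖c‖_∞(2 + τ + τ·mean speed)`, mean speed `≤ 1 + mean energy` (conserved). [folklore] -/
def FreeCollisionalBalanceKN : Prop :=
  ∀ (a : ℝ → ℝ), ContDiff ℝ 1 a → ∀ (b : T3 → ℝ), Literature.Analysis.FunctionSpaces.Torus.IsSmooth b →
  ∀ (c : V3 → ℝ) (Cc : ℝ), (∀ v, |c v| ≤ Cc) → ∀ τ : ℝ, 0 < τ →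
  ∃ C : ℝ, ∀ σ : ℝ, 0 < σ → ∀ (N : ℕ) (Φ : HardSphereFlow (Torus.geometry (Fin 3)) (hsDiameter σ N) (N + 1)),
  ∀ z ∈ Φ.good, (0 : ℝ) ∉ collisionTimes (Torus.geometry (Fin 3)) (hsDiameter σ N) (fun s => Φ.flow s z) →
  ∀ r : ℝ,
    |collisionSum σ N Φ τ (fun p => a p.1 * b p.2) (fun _ => 1)
        (fun q => c (reflectVel q.1 (q.2.1, q.2.2)).1 - c q.2.1) r z|
      ≤ hsDiameter σ N * C * (1 + ((N : ℝ) + 1)⁻¹ * ∑ i, ‖(z i).2‖ ^ 2)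

/-- **DIAGONAL PARITY RIGIDITY** (conclusion of S3c-b; text verbatim from `KineticSlavingPlan.lean` I₃): window laws `m_n → m`
(weakly with convergent quadratic-growth statistics), mollifier widths `ϑ_n → 0⁺`, and vanishing entropy production of
`(G_{ϑ_n} ∗ m_n ; m_n ⊗ m_n)` force `m` to be a Dirac mass or a Maxwellian — the diagonal version of the PROVED `ParityRigidity`
(`parityRigidity_proof`, one fixed `m`, `ϑ → 0⁺`) that the as-typed quantifier order of `OddContactSymmetry` (`ϑ < r₀(η,δ)`) demands
(audit h3).  Size L, moderate risk (the mollified Radon–Nikodym ratio of MOVING measures at scale `ϑ_n` is the one estimate not in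
tree); no counterexample among atoms/mixtures. [folklore] -/
def DiagonalParityRigidity : Prop :=
  ∀ (ms : ℕ → Measure V3) (m : Measure V3) (ϑs : ℕ → ℝ),
    (∀ n, IsProbabilityMeasure (ms n)) → IsProbabilityMeasure m →
    (∀ n, 0 < ϑs n) → Tendsto ϑs atTop (𝓝 0) →
    (∀ n, Integrable (fun v : V3 => ‖v‖ ^ 2) (ms n)) → Integrable (fun v : V3 => ‖v‖ ^ 2) m →
    (∀ G : V3 → ℝ, Continuous G → (∃ C : ℝ, ∀ v, |G v| ≤ C * (1 + ‖v‖ ^ 2)) →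
      Tendsto (fun n => ∫ v, G v ∂(ms n)) atTop (𝓝 (∫ v, G v ∂m))) →
    (let h : ℕ → V3 → ℝ := fun n v => ∫ v', localMaxwellian 1 (ϑs n ^ 2) v v' ∂(ms n)
     let F : ℕ → Metric.sphere (0 : V3) 1 → V3 × V3 → ℝ := fun n ω p =>
       Real.log (h n p.1) + Real.log (h n p.2) - Real.log (h n (collide ω p).1) -
         Real.log (h n (collide ω p).2)
     Tendsto (fun n => ∫⁻ p, ∫⁻ ω, ENNReal.ofReal (hardSphereKernel (p.2, p.1) ω *
        (F n ω p * (1 - Real.exp (-F n ω p)))) ∂sphereMeasure ∂((ms n).prod (ms n))) atTop (𝓝 0)) →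
    (∃ u : V3, m = Measure.dirac u) ∨
      (∃ θ : ℝ, ∃ u : V3, 0 < θ ∧
        m = (volume : Measure V3).withDensity (fun v => ENNReal.ofReal (localMaxwellian 1 θ u v)))

/-- **DIAGONAL COLLISION INVARIANCE** (conclusion of S3c-b', the ONE remaining estimate of the diagonal rigidity after wave 3; text =
antecedent of the LANDED reduction `stub_diagonalParityRigidity_of_ae_map_collide_eq`, p152253): under the hypotheses of
`DiagonalParityRigidity`, the limit pair law `m ⊗ m` is `collide ω`-invariant for a.e. `ω`.  Worker S3c-b (STATUS file
`stub_diagonalParityRigidity-STATUS.md`): TRUE with high confidence (no counterexample among lattice / cluster / shell / two-temperature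
families); the fixed-law Gaussian relative differentiation has no diagonal analogue and the per-measure abstraction is FALSE (7-simplex
clusters); the surviving mechanism is Bochner positivity of the Gaussian kernel — LANDED: defect `∫∫ B |1 − e^{−F_n}| → 0` (p152891), the
energy identity / fixed-width invariance (p153152), the identification from renormalised energy (p154051); MISSING: the de-weighting
estimate `∫ β_ω (ν_n ∗ G_{ϑ_n²}) |1 − e^{−F_n}| dν_n → 0` (trivial under `sup_n ‖m_n ∗ G_{ϑ_n²}‖_∞ < ∞`, which the stub does not give;
without it: tightness of the mollified density under `ν_n` away from the diagonal — multi-session, carries the risk).  Planner-level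
alternative: re-type 17722 with `∃ ϑ₀ ∀ ϑ < ϑ₀` before `∀ η δ` (then `parityRigidity_proof` / `dirac_or_maxwellian_of_tendsto_seq` suffice
and this stub disappears). [folklore] -/
def DiagonalCollisionInvariance : Prop :=
  ∀ (ms : ℕ → Measure V3) (m : Measure V3) (ϑs : ℕ → ℝ),
    (∀ n, IsProbabilityMeasure (ms n)) → IsProbabilityMeasure m →
    (∀ n, 0 < ϑs n) → Tendsto ϑs atTop (𝓝 0) →
    (∀ n, Integrable (fun v : V3 => ‖v‖ ^ 2) (ms n)) → Integrable (fun v : V3 => ‖v‖ ^ 2) m →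
    (∀ G : V3 → ℝ, Continuous G → (∃ C : ℝ, ∀ v, |G v| ≤ C * (1 + ‖v‖ ^ 2)) →
      Tendsto (fun n => ∫ v, G v ∂(ms n)) atTop (𝓝 (∫ v, G v ∂m))) →
    (let h : ℕ → V3 → ℝ := fun n v => ∫ v', localMaxwellian 1 (ϑs n ^ 2) v v' ∂(ms n)
     let F : ℕ → Metric.sphere (0 : V3) 1 → V3 × V3 → ℝ := fun n ω p =>
       Real.log (h n p.1) + Real.log (h n p.2) - Real.log (h n (collide ω p).1) -
         Real.log (h n (collide ω p).2)
     Tendsto (fun n => ∫⁻ p, ∫⁻ ω, ENNReal.ofReal (hardSphereKernel (p.2, p.1) ω *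
        (F n ω p * (1 - Real.exp (-F n ω p)))) ∂sphereMeasure ∂((ms n).prod (ms n))) atTop (𝓝 0)) →
    ∀ᵐ ω ∂(sphereMeasure : Measure (Metric.sphere (0 : V3) 1)), (m.prod m).map (collide ω) = m.prod m

/-! ## §2 Sorry-free glue: frame lemma, pre-shock union bound, pre-shock identification -/

/-- **The filed crux implies its pre-shock form** (the Euler solution, the `t = 0` LLN and `τ < T` are discarded): the frame
gap `stub_frameGap` is the ONLY gap between the two, and it is the converse of THIS implication. [folklore] -/
theorem preShock_of_crux (h : EvenStressEnskog) : EvenStressEnskogPreShock :=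
  -- LANDED p140487 (wave 1): Theorems/JParityClosureEvenStressEnskogPreShockGlue.lean, def-free
  Summit.AtomisticToContinuum.HydrodynamicLimit.Theorems.EvenStressEnskog.preShock_of_evenStressEnskog h

/-- **The pre-shock crux from its pre-shock contact side and Enskog side** — the landed union bound
`evenStressEnskog_of_sides` (`{η < |K − E|} ⊆ {η/2 < |K − C|} ∪ {η/2 < |C − E|}` pair by pair, thresholds by `min`/`max`,
`lgr_exists_r₀_N₀_forall_fin3`) re-threaded with the binders `T ρ θ u, hEuler, Φ, hLLN, τ, hτ, hτT`. [folklore] -/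
theorem evenStressEnskogPreShock_of_sides (hC : ContactEvenPreShock) (hE : EnskogSidePreShock) :
    EvenStressEnskogPreShock :=
  -- LANDED p140487 (wave 1): Theorems/JParityClosureEvenStressEnskogPreShockGlue.lean, def-free
  Summit.AtomisticToContinuum.HydrodynamicLimit.Theorems.EvenStressEnskog.evenStressEnskogPreShock_of_sides hC hE

/-- **The pre-shock Enskog side IS the pre-shock one-body statement (L1) for the weight `g·Ỹ·a` and the test functions
`F_{kl}`** — the landed identification `stub_enskogIdentification_of_pointwise stub_enskogPointwise` (p134407 / p127996:
on the good set `contactPredM − σ³∫₀^τ enskogRate = oneBodyPred kw F_{kl} − oneBodyStat kw F_{kl}` EXACTLY,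
`contactPredM_sub_enskog_eq_oneBodyPred_sub_oneBodyStat`; the bad set is null, `localGibbsLaw_compl_good`; `η₀ := min η₀^{(L1)} η_Y`
with `Ỹ` the analytic clamp of `exists_contactValue_clamp`) re-threaded in the pre-shock frame.  Sorry-free. [folklore] -/
theorem enskogSidePreShock_of_velocityEquilibration (hL1 : VelocityEquilibrationPreShock) : EnskogSidePreShock :=
  -- LANDED p140487 (wave 1): Theorems/JParityClosureEvenStressEnskogPreShockGlue.lean, def-free
  Summit.AtomisticToContinuum.HydrodynamicLimit.Theorems.EvenStressEnskog.enskogSidePreShock_of_velocityEquilibrationPreShock hL1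

/-- **Converse in the two-body slot** (LANDED p140298, lead): the pre-shock crux and the pre-shock Enskog side give back the
pre-shock contact side — modulo the kinetic half the crux child `ContactEvenPreShock` is EQUIVALENT to the restated crux. [folklore] -/
theorem contactEvenPreShock_of_preShock_of_enskogSide (hX : EvenStressEnskogPreShock) (hE : EnskogSidePreShock) :
    ContactEvenPreShock :=
  Summit.AtomisticToContinuum.HydrodynamicLimit.Theorems.EvenStressEnskog.contactEvenPreShock_of_evenStressEnskogPreShock_of_enskogSidePreShock hX hE

/-! ## §3 The seven registered stubs (lead c7 reshape v1: S3 ↦ S3a, S3b, S3c; reshape v2: S3a landed, S3b ↦ S3b1, S3b2, S3b3)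
(each: the statement `Prop` `Stubs.stub_*`, then the sorried theorem `stub_*` with the same text) -/

/-- **S1 · FRAME GAP** — `EvenStressEnskogPreShock → EvenStressEnskog`: the filed `∀ τ`, untied form from the pre-shock,
data-tied form.  CONTENT (Disproof §6.5(5), §12; lead c6 `RestatePreShock.lean` / PICKED point 1): the crux for
`(profiles, σ, τ)` admitting no classical LLN-tied hs-Euler solution through time `τ` — post-blow-up times (where Disproof §12's
mesoscale compactness = a K41-type no-energy-pile-up statement for deterministic spheres is tacitly asserted by the
h-blind `B_r`) and continuous-but-rough data.  NOT CONSUMED BY `closes` (ParityInBand / ParityBandClosure use `τ < T`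
instances only, c6).  Size: open-problem as mathematics; `id` after the restatement R recommended by the standing disprover,
leads c5/c6/a1/a2 and this strategist (then `EvenStressEnskog` unfolds to the pre-shock body).  A stub-worker's correct
answer today is `verdict: misstated — restate R`; a lead must NOT spend cycles here. [folklore] -/
def Stubs.stub_frameGap : Prop := EvenStressEnskogPreShock → EvenStressEnskog

theorem stub_frameGap : EvenStressEnskogPreShock → EvenStressEnskog := by
  sorry

/-- **S2 · CONTACT SIDE, PRE-SHOCK, EVEN MARKS (THE CORE)** — `ContactEvenPreShock`.  Why plausibly true: at a
local-equilibrium state the equal-time pre-collisional contact pair law of the Gibbs measure is `Y(η) ρ² M⊗M` (statics: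
contact theorem `HardSphereContactTheorem_holds`, KS two-cluster factorisation p112368/p115782, rung 0 of the crux PROVED
`evenStressEnskog_rung0` p121729); off equilibrium the J-even contact corrections (ring / repeated-collision terms,
shear-induced contact anisotropy) are responses to gradients, `O(Kn) = O((N+1)^{-1/3})` at Euler scaling, and to first
order vanish at shifted equilibria (`zeroFrequencyRingOperator_eq_zero_of_isCollisionInvariant`, PROVED); EDMD j010547:
collision side = Enskog/CS to 0.5 %, no non-equilibrium anomaly at 0.5–1.5 % on Mach-0.6 shear / ±70 % temperature waves.
What is OPEN is exactly propagation of two-body local equilibrium at contact over Euler times at fixed reduced density,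
PRE-SHOCK (no texture/compactness content: §12 does not bite for `τ < T`, §12(i)).  Size: open-problem (= the crux's own
`[difficulty: open-problem]`, now minimal).  Landable partial targets for a lead (each `--supports stmt-13079`): (a) this
statement at rung 0 from `evenStressEnskog_rung0` + the Enskog side at rung 0 via `contactSide_of_evenStressEnskog_of_enskogSide`;
(b) the pre-shock glue of this file as a Theorems file (the post-R decomposition glue); (c) its trace instance ⇔ the
pre-shock impulse-rate / collisional-pressure law (Disproof §8 pattern).  Leans on: `collisionSum`, `contactPredM`,
`localGibbsLaw`, `IsHardSphereEulerSolution`, `TendstoHydroFieldsAt`; ChapmanCowling1970 Ch. 16, VanbeijerenErnst1973,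
Resibois1978, Spohn1991 I §3.2–3.3, OllaVaradhanYau1993 (with noise), Lutsko1996/2001 (MD contact statistics). [folklore] -/
def Stubs.stub_contactEvenPreShock : Prop := ContactEvenPreShock

theorem stub_contactEvenPreShock : ContactEvenPreShock := by
  sorry

/-- **S3a · QUADRATIC-TEST CONVERGENCE (TOOL of S3; pure measure theory, closable now)** — weak convergence of finite
measures on `V3 = ℝ³` together with convergence of the second moments upgrades to convergence of the integrals of every
continuous test function of quadratic growth `|F v| ≤ C(1 + ‖v‖²)` (uniform integrability of `‖v‖²` from the convergence of
`∫‖v‖²`; truncation by a continuous cut-off, the bounded part by weak convergence, the tail by the second-moment budget of the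
limit).  It is step (iii) of S3 ("KineticEnergyTails upgrades weak convergence of the `r`-ball laws to convergence of second
moments / of quadratic-growth statistics") and equally the "law ⇒ stress" step of `ParityBandClosure`; stated for an arbitrary
filter so that it serves subsequential limits.  Size: M.  Leans on: Mathlib `MeasureTheory.FiniteMeasure` (topology of weak
convergence, `tendsto_iff_forall_integral_tendsto`), dominated convergence. [folklore] -/
def Stubs.stub_quadraticTestConvergence : Prop :=
  ∀ {ι : Type} (l : Filter ι) (μs : ι → FiniteMeasure V3) (ν : FiniteMeasure V3),
    Tendsto μs l (𝓝 ν) →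
    (∀ i, Integrable (fun v : V3 => ‖v‖ ^ 2) (μs i : Measure V3)) →
    Integrable (fun v : V3 => ‖v‖ ^ 2) (ν : Measure V3) →
    Tendsto (fun i => ∫ v, ‖v‖ ^ 2 ∂(μs i : Measure V3)) l (𝓝 (∫ v, ‖v‖ ^ 2 ∂(ν : Measure V3))) →
    ∀ F : V3 → ℝ, Continuous F → (∃ C : ℝ, ∀ v, |F v| ≤ C * (1 + ‖v‖ ^ 2)) →
      Tendsto (fun i => ∫ v, F v ∂(μs i : Measure V3)) l (𝓝 (∫ v, F v ∂(ν : Measure V3)))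

theorem stub_quadraticTestConvergence :
    ∀ {ι : Type} (l : Filter ι) (μs : ι → FiniteMeasure V3) (ν : FiniteMeasure V3),
    Tendsto μs l (𝓝 ν) →
    (∀ i, Integrable (fun v : V3 => ‖v‖ ^ 2) (μs i : Measure V3)) →
    Integrable (fun v : V3 => ‖v‖ ^ 2) (ν : Measure V3) →
    Tendsto (fun i => ∫ v, ‖v‖ ^ 2 ∂(μs i : Measure V3)) l (𝓝 (∫ v, ‖v‖ ^ 2 ∂(ν : Measure V3))) →
    ∀ F : V3 → ℝ, Continuous F → (∃ C : ℝ, ∀ v, |F v| ≤ C * (1 + ‖v‖ ^ 2)) →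
      Tendsto (fun i => ∫ v, F v ∂(μs i : Measure V3)) l (𝓝 (∫ v, F v ∂(ν : Measure V3))) :=
  -- LANDED p140362 (wave 1, worker S3a): Theorems/JParityClosureEvenStressEnskogQuadraticTestConvergence.lean
  Summit.AtomisticToContinuum.HydrodynamicLimit.Theorems.EvenStressEnskog.stub_quadraticTestConvergence

/-- **S3b · VELOCITY EQUILIBRATION AT RUNG 0 (the constant-profile instance of S3's conclusion; closable now)** — under the
local Gibbs law with CONSTANT profiles `(a, u, θ)` (= the canonical Gibbs measure, invariant under every hard-sphere flow,
`map_flow_localGibbsLaw_const`; velocities i.i.d. `gaussMeasure u θ` independent of the positions,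
`stub_velocityFactorisationRung0` p82456) the `r`-ball one-body statistic `oneBodyStat` of every continuous quadratic-growth
test function `F(v, u_r, θ_r)` read at its OWN empirical parameters is `η`-close in probability to its local-Maxwellian
prediction `oneBodyPred`, `N → ∞` at fixed `r` (then `r → 0` is idle): flow invariance + translation invariance reduce the
time-and-space integral to ONE ball at time `0` (Tonelli, `|χ| ≤ C`), where it is the plug-in law of large numbers for
`(N+1)⁻¹ Σ b_r(x_i) F(v_i, u_r, θ_r)` given the positions (`u_r → u`, `θ_r → θ`, `ρ_r → 1`; continuity of
`(u', θ') ↦ ∫ F(·, u', θ') dM_{1,θ',u'}` at `θ > 0`; tails by the Gaussian fourth moment), then Markov.  It is the rung 0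
of the pre-shock statement `VelocityEquilibrationPreShock` (whose Euler-solution / LLN hypotheses are simply discarded at
constant profiles) and, through the landed identification identity, gives the Enskog side and hence (with
`evenStressEnskog_rung0`, p121729) the contact side `ContactEvenPreShock` at rung 0 (lead's partial (a) of S2).  Size: L.
Leans on: `map_flow_localGibbsLaw_const`, `stub_velocityFactorisationRung0`, `integral_localGibbsLaw_const_eq_integral_integral`,
`integrableOn_oneBodyStat_flow` / `integrableOn_oneBodyPred_flow` (p130698), `measure_lt_abs_setIntegral_flow_le`,
`mollDensity_mul_mollTemperature_le`, `localGibbs_lln_holds`, Mathlib strong law / Chebyshev. [folklore] -/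
def Stubs.stub_velocityEquilibrationRung0 : Prop :=
  ∃ η₀ : ℝ, 0 < η₀ ∧ ∀ (a θ : ℝ) (u : V3), 0 < a → 0 < θ → ∃ σ₀ : ℝ, 0 < σ₀ ∧ ∀ σ : ℝ, 0 < σ → σ < σ₀ →
    ∀ Φ : (N : ℕ) → HardSphereFlow (Torus.geometry (Fin 3)) (hsDiameter σ N) (N + 1),
    ∀ τ : ℝ, 0 < τ →
    ∀ χ : ℝ × T3 → ℝ, Continuous χ → ∀ k : ℝ → ℝ, Continuous k → (∀ b, η₀ ≤ b → k b = 0) →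
    ∀ F : V3 × V3 × ℝ → ℝ, Continuous F →
    (∃ C : ℝ, ∀ q, |F q| ≤ C * (1 + ‖q.1‖ ^ 2 + ‖q.2.1‖ ^ 2 + |q.2.2|)) →
    ∀ η δ : ℝ, 0 < η → 0 < δ → ∃ r₀ : ℝ, 0 < r₀ ∧ ∀ r : ℝ, 0 < r → r < r₀ → ∃ N₀ : ℕ, ∀ N : ℕ, N₀ ≤ N →
      localGibbsLaw σ (fun _ => a) (fun _ => u) (fun _ => θ) N (Φ N)
        {z | η < |oneBodyStat σ N (Φ N) τ χ k F r z - oneBodyPred σ N (Φ N) τ χ k F r z|}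
        ≤ ENNReal.ofReal δ

/-! ### S3b, reshape v2 (lead c7, wave 2): three registered pieces S3b1–S3b3 and the derivation of S3b

The proof of S3b is the plug-in law of large numbers sketched in its docstring, cut at its two natural seams:
STATICS AT A POINT (S3b1: everything about the rung-0 law `G_N = zipConfig_# (posGibbs ⊗ ⊗ᵢ N(u, θ id))` at ONE
window centre `x` — probability, velocity moment bounds, the `L²` law of large numbers of the mollified density
(`tendsto_variance_uniform`, `∫ b_r = 1`) and of every velocity test `∫ b_r(y,x) G(v) dμ_w` (conditionally centred,
variance `≤ (3/πr³)² Var_γ(G)/(N+1)`), and the concentration of the window parameters `(ρ_r, u_r, θ_r) → (1, u, θ)`),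
the POINTWISE `L¹` DEVIATION (S3b2: at one `x`, `E_{G_N}|∫ b_r F(v,u_r,θ_r) dμ_w − ρ_r ⟨F(·,u_r,θ_r)⟩_{M_{1,θ_r,u_r}}| → 0`
— continuity of `F` on compacta + Gaussian tails + the landed `continuousAt_integral_mul_localMaxwellian` (p140467) +
uniform integrability from the moment bounds), and the ASSEMBLY (S3b3: Tonelli over `x ∈ 𝕋³` with dominated
convergence, flow invariance `lintegral_comp_flow_localGibbsLaw_const` over `s ∈ [0, τ]`, the reduction
`|oneBodyStat − oneBodyPred| ≤ C_χ C_k ∫₀^τ∫ |D|` on good orbits, Markov).  All three are stated with `∫⁻`/`ENNReal.ofReal`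
(no Bochner junk in a hypothesis) and in tree vocabulary only. -/

/-- **Rung-0 local statistics at a window centre** (conclusion of S3b1).  For constant profiles `(a, u, θ)`, `σ`
small, EVERY flow family (the flow only fixes the phase space: `localGibbsLaw_eq`), with `G_N` the rung-0 local Gibbs law:
(i) `G_N` is a probability measure; (ii) uniform bounds on the first two moments of the empirical kinetic energy
`(N+1)⁻¹ Σᵢ ‖vᵢ‖²` (velocity marginal `⊗ᵢ N(u, θ id)`, `localGibbsMeasure_rung0_eq_map`); and at every scale
`0 < r < 1/2` and centre `x`: (iii) `E (ρ_r(x) − 1)² → 0` (`tendsto_variance_uniform` with `χ = b_r(·, x)`,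
`integral_coneKernel`); (iv) for every continuous `G` of quadratic growth,
`E (∫ b_r(y,x) G(v) dμ_w − ρ_r(x) ∫ G dN(u,θ id))² → 0` (conditionally on the positions the summands are independent
and centred: variance `≤ (3/πr³)² Var(G)/(N+1)`); (v) concentration of the window parameters,
`G_N {ι ≤ |ρ_r(x) − 1| + ‖u_r(x) − u‖ + |θ_r(x) − θ|} → 0` ((iii) + (iv) for `G = v_l`, `‖v‖²/2`
(`integral_coord_gaussMeasure`, `integral_energy_gaussMeasure`) + Chebyshev + continuity of
`(ρ, m, e) ↦ (m/ρ, (2/3)(e/ρ − ‖m‖²/(2ρ²)))` at `ρ = 1`). [folklore] -/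
def Rung0LocalStatistics : Prop :=
  ∀ (a θ : ℝ) (u : V3), 0 < a → 0 < θ → ∃ σ₀ : ℝ, 0 < σ₀ ∧ ∀ σ : ℝ, 0 < σ → σ < σ₀ →
    ∀ Φ : (N : ℕ) → HardSphereFlow (Torus.geometry (Fin 3)) (hsDiameter σ N) (N + 1),
    (∀ N, IsProbabilityMeasure (localGibbsLaw σ (fun _ => a) (fun _ => u) (fun _ => θ) N (Φ N))) ∧
    (∃ K : ℝ, ∀ N : ℕ,
      ∫⁻ w, ENNReal.ofReal (((N + 1 : ℕ) : ℝ)⁻¹ * ∑ i, ‖(w i).2‖ ^ 2)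
          ∂(localGibbsLaw σ (fun _ => a) (fun _ => u) (fun _ => θ) N (Φ N)) ≤ ENNReal.ofReal K ∧
      ∫⁻ w, ENNReal.ofReal ((((N + 1 : ℕ) : ℝ)⁻¹ * ∑ i, ‖(w i).2‖ ^ 2) ^ 2)
          ∂(localGibbsLaw σ (fun _ => a) (fun _ => u) (fun _ => θ) N (Φ N)) ≤ ENNReal.ofReal K) ∧
    ∀ r : ℝ, 0 < r → r < 1 / 2 → ∀ x : T3,
      Tendsto (fun N : ℕ => ∫⁻ w, ENNReal.ofReal ((mollDensity r w x - 1) ^ 2)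
        ∂(localGibbsLaw σ (fun _ => a) (fun _ => u) (fun _ => θ) N (Φ N))) atTop (𝓝 0) ∧
      (∀ G : V3 → ℝ, Continuous G → (∃ C : ℝ, ∀ v, |G v| ≤ C * (1 + ‖v‖ ^ 2)) →
        Tendsto (fun N : ℕ => ∫⁻ w, ENNReal.ofReal
            (((∫ q, coneKernel r q.1 x * G q.2 ∂(empiricalMeasure w)) -
              mollDensity r w x * ∫ v, G v ∂(gaussMeasure u θ)) ^ 2)
          ∂(localGibbsLaw σ (fun _ => a) (fun _ => u) (fun _ => θ) N (Φ N))) atTop (𝓝 0)) ∧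
      ∀ ι : ℝ, 0 < ι →
        Tendsto (fun N : ℕ => localGibbsLaw σ (fun _ => a) (fun _ => u) (fun _ => θ) N (Φ N)
          {w | ι ≤ |mollDensity r w x - 1| + ‖KineticEntropyBalance.uC r w x - u‖ +
            |mollTemperature r w x - θ|}) atTop (𝓝 0)

/-- **Pointwise `L¹` one-body deviation at rung 0** (conclusion of S3b2).  For constant profiles, `σ` small, every flow
family, every continuous `F(v, u, θ)` of growth `|F| ≤ C(1 + ‖v‖² + ‖u‖² + |θ|)`, every scale `0 < r < 1/2` and centre
`x`: the Gibbs `L¹` norm of the window deviation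
`D_F(w, x) = ∫ b_r(y,x) F(v, u_r(x), θ_r(x)) dμ_w(y,v) − ρ_r(x) ∫ F(v, u_r, θ_r) M_{1,θ_r,u_r}(v) dv` is eventually `≤ ε`
(`N → ∞` at fixed `r`, `x`; `N₀` may depend on `x`).  Route: split `D_F` at the true parameters `p* = (u, θ)`:
`∫ b_r [F(v,p_r) − F(v,p*)] dμ` (uniform continuity of `F` on `‖v‖ ≤ L` × a ball at `p*`, Gaussian tails through S3b1(iv)
with a continuous tail weight, the bad event `{‖p_r − p*‖ ≥ ι}` by Cauchy–Schwarz against the moment bounds),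
`∫ b_r F(v,p*) dμ − ρ_r ∫ F(·,p*) dγ` (S3b1(iv)), `∫ F(·,p*) dγ = ∫ F(·,p*) M_{1,θ,u}`
(`integral_localMaxwellian_mul_eq_integral_gaussMeasure`), and `ρ_r [H(p*) − H(p_r)]` with
`H(p) = ∫ F(v,p) M_{1,p}(v) dv` continuous at `p*` (`continuousAt_integral_mul_localMaxwellian`, p140467) — each `→ 0` in
probability with the uniformly integrable envelope `C'(ρ_r + e_r)` (`ρ_r‖u_r‖² ≤ 2e_r`, `ρ_rθ_r ≤ (2/3)e_r`,
`avg_coneKernel_mul_norm_sub_uC_sq_le`, `mollDensity_mul_mollTemperature_le`). [folklore] -/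
def OneBodyDeviationRung0 : Prop :=
  ∀ (a θ : ℝ) (u : V3), 0 < a → 0 < θ → ∃ σ₀ : ℝ, 0 < σ₀ ∧ ∀ σ : ℝ, 0 < σ → σ < σ₀ →
    ∀ Φ : (N : ℕ) → HardSphereFlow (Torus.geometry (Fin 3)) (hsDiameter σ N) (N + 1),
    ∀ F : V3 × V3 × ℝ → ℝ, Continuous F →
    (∃ C : ℝ, ∀ q, |F q| ≤ C * (1 + ‖q.1‖ ^ 2 + ‖q.2.1‖ ^ 2 + |q.2.2|)) →
    ∀ r : ℝ, 0 < r → r < 1 / 2 → ∀ x : T3, ∀ ε : ℝ, 0 < ε → ∃ N₀ : ℕ, ∀ N : ℕ, N₀ ≤ N →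
      ∫⁻ w, ENNReal.ofReal
          |(∫ q, coneKernel r q.1 x *
                F (q.2, KineticEntropyBalance.uC r w x, mollTemperature r w x) ∂(empiricalMeasure w)) -
            mollDensity r w x *
              ∫ v, F (v, KineticEntropyBalance.uC r w x, mollTemperature r w x) *
                localMaxwellian 1 (mollTemperature r w x) (KineticEntropyBalance.uC r w x) v|
        ∂(localGibbsLaw σ (fun _ => a) (fun _ => u) (fun _ => θ) N (Φ N)) ≤ ENNReal.ofReal ε

/-- **S3b1 · RUNG-0 LOCAL STATISTICS (statics at a point; closable now, M–L).**  Leans on: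
`isProbabilityMeasure_localGibbsLaw`, `localGibbsMeasure_rung0_eq_map` / `integral_localGibbsLaw_rung0` (HardSphereUniformGas),
`exists_smallDensity`, `tendsto_variance_uniform`, `integral_coneKernel`, `integral_posGibbsMeasure_const`,
`pi_measure_avg_ge_le` / the variance of an average of independent centred terms, `integral_gaussMeasure`,
`integral_coord_gaussMeasure`, `integral_energy_gaussMeasure`, `integrable_norm_pow_four_stdGaussian`, `coneKernel_mem_Icc`,
`mollKineticEnergy_le`, measurability lemmas of `…EnskogIdentificationFields`. [folklore] -/
def Stubs.stub_rung0LocalStatistics : Prop := Rung0LocalStatistics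

theorem stub_rung0LocalStatistics :
    ∀ (a θ : ℝ) (u : V3), 0 < a → 0 < θ → ∃ σ₀ : ℝ, 0 < σ₀ ∧ ∀ σ : ℝ, 0 < σ → σ < σ₀ →
    ∀ Φ : (N : ℕ) → HardSphereFlow (Torus.geometry (Fin 3)) (hsDiameter σ N) (N + 1),
    (∀ N, IsProbabilityMeasure (localGibbsLaw σ (fun _ => a) (fun _ => u) (fun _ => θ) N (Φ N))) ∧
    (∃ K : ℝ, ∀ N : ℕ,
      ∫⁻ w, ENNReal.ofReal (((N + 1 : ℕ) : ℝ)⁻¹ * ∑ i, ‖(w i).2‖ ^ 2)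
          ∂(localGibbsLaw σ (fun _ => a) (fun _ => u) (fun _ => θ) N (Φ N)) ≤ ENNReal.ofReal K ∧
      ∫⁻ w, ENNReal.ofReal ((((N + 1 : ℕ) : ℝ)⁻¹ * ∑ i, ‖(w i).2‖ ^ 2) ^ 2)
          ∂(localGibbsLaw σ (fun _ => a) (fun _ => u) (fun _ => θ) N (Φ N)) ≤ ENNReal.ofReal K) ∧
    ∀ r : ℝ, 0 < r → r < 1 / 2 → ∀ x : T3,
      Tendsto (fun N : ℕ => ∫⁻ w, ENNReal.ofReal ((mollDensity r w x - 1) ^ 2)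
        ∂(localGibbsLaw σ (fun _ => a) (fun _ => u) (fun _ => θ) N (Φ N))) atTop (𝓝 0) ∧
      (∀ G : V3 → ℝ, Continuous G → (∃ C : ℝ, ∀ v, |G v| ≤ C * (1 + ‖v‖ ^ 2)) →
        Tendsto (fun N : ℕ => ∫⁻ w, ENNReal.ofReal
            (((∫ q, coneKernel r q.1 x * G q.2 ∂(empiricalMeasure w)) -
              mollDensity r w x * ∫ v, G v ∂(gaussMeasure u θ)) ^ 2)
          ∂(localGibbsLaw σ (fun _ => a) (fun _ => u) (fun _ => θ) N (Φ N))) atTop (𝓝 0)) ∧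
      ∀ ι : ℝ, 0 < ι →
        Tendsto (fun N : ℕ => localGibbsLaw σ (fun _ => a) (fun _ => u) (fun _ => θ) N (Φ N)
          {w | ι ≤ |mollDensity r w x - 1| + ‖KineticEntropyBalance.uC r w x - u‖ +
            |mollTemperature r w x - θ|}) atTop (𝓝 0) :=
  -- LANDED p144623 (wave 2, worker S3b1): Theorems/JParityClosureEvenStressEnskogRung0LocalStatistics.lean
  Summit.AtomisticToContinuum.HydrodynamicLimit.Theorems.EvenStressEnskog.stub_rung0LocalStatistics

/-- **S3b2 · POINTWISE `L¹` ONE-BODY DEVIATION AT RUNG 0 (closable now, L)** — from S3b1.  Leans on: S3b1 (as hypothesis),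
`continuousAt_integral_mul_localMaxwellian` (p140467), `integral_localMaxwellian_mul_eq_integral_gaussMeasure`,
`avg_coneKernel_mul_norm_sub_uC_sq_le`, `mollDensity_mul_mollTemperature_le`, `mollKineticEnergy_le`, `coneKernel_mem_Icc`,
`abs_le_add_sq_div`, `IsCompact.uniformContinuousOn_of_continuous`, Chebyshev / Cauchy–Schwarz in `∫⁻` form. [folklore] -/
def Stubs.stub_oneBodyDeviationRung0 : Prop := Rung0LocalStatistics → OneBodyDeviationRung0

theorem stub_oneBodyDeviationRung0 :
    (∀ (a θ : ℝ) (u : V3), 0 < a → 0 < θ → ∃ σ₀ : ℝ, 0 < σ₀ ∧ ∀ σ : ℝ, 0 < σ → σ < σ₀ →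
    ∀ Φ : (N : ℕ) → HardSphereFlow (Torus.geometry (Fin 3)) (hsDiameter σ N) (N + 1),
    (∀ N, IsProbabilityMeasure (localGibbsLaw σ (fun _ => a) (fun _ => u) (fun _ => θ) N (Φ N))) ∧
    (∃ K : ℝ, ∀ N : ℕ,
      ∫⁻ w, ENNReal.ofReal (((N + 1 : ℕ) : ℝ)⁻¹ * ∑ i, ‖(w i).2‖ ^ 2)
          ∂(localGibbsLaw σ (fun _ => a) (fun _ => u) (fun _ => θ) N (Φ N)) ≤ ENNReal.ofReal K ∧
      ∫⁻ w, ENNReal.ofReal ((((N + 1 : ℕ) : ℝ)⁻¹ * ∑ i, ‖(w i).2‖ ^ 2) ^ 2)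
          ∂(localGibbsLaw σ (fun _ => a) (fun _ => u) (fun _ => θ) N (Φ N)) ≤ ENNReal.ofReal K) ∧
    ∀ r : ℝ, 0 < r → r < 1 / 2 → ∀ x : T3,
      Tendsto (fun N : ℕ => ∫⁻ w, ENNReal.ofReal ((mollDensity r w x - 1) ^ 2)
        ∂(localGibbsLaw σ (fun _ => a) (fun _ => u) (fun _ => θ) N (Φ N))) atTop (𝓝 0) ∧
      (∀ G : V3 → ℝ, Continuous G → (∃ C : ℝ, ∀ v, |G v| ≤ C * (1 + ‖v‖ ^ 2)) →
        Tendsto (fun N : ℕ => ∫⁻ w, ENNReal.ofReal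
            (((∫ q, coneKernel r q.1 x * G q.2 ∂(empiricalMeasure w)) -
              mollDensity r w x * ∫ v, G v ∂(gaussMeasure u θ)) ^ 2)
          ∂(localGibbsLaw σ (fun _ => a) (fun _ => u) (fun _ => θ) N (Φ N))) atTop (𝓝 0)) ∧
      ∀ ι : ℝ, 0 < ι →
        Tendsto (fun N : ℕ => localGibbsLaw σ (fun _ => a) (fun _ => u) (fun _ => θ) N (Φ N)
          {w | ι ≤ |mollDensity r w x - 1| + ‖KineticEntropyBalance.uC r w x - u‖ +
            |mollTemperature r w x - θ|}) atTop (𝓝 0)) →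
    ∀ (a θ : ℝ) (u : V3), 0 < a → 0 < θ → ∃ σ₀ : ℝ, 0 < σ₀ ∧ ∀ σ : ℝ, 0 < σ → σ < σ₀ →
    ∀ Φ : (N : ℕ) → HardSphereFlow (Torus.geometry (Fin 3)) (hsDiameter σ N) (N + 1),
    ∀ F : V3 × V3 × ℝ → ℝ, Continuous F →
    (∃ C : ℝ, ∀ q, |F q| ≤ C * (1 + ‖q.1‖ ^ 2 + ‖q.2.1‖ ^ 2 + |q.2.2|)) →
    ∀ r : ℝ, 0 < r → r < 1 / 2 → ∀ x : T3, ∀ ε : ℝ, 0 < ε → ∃ N₀ : ℕ, ∀ N : ℕ, N₀ ≤ N →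
      ∫⁻ w, ENNReal.ofReal
          |(∫ q, coneKernel r q.1 x *
                F (q.2, KineticEntropyBalance.uC r w x, mollTemperature r w x) ∂(empiricalMeasure w)) -
            mollDensity r w x *
              ∫ v, F (v, KineticEntropyBalance.uC r w x, mollTemperature r w x) *
                localMaxwellian 1 (mollTemperature r w x) (KineticEntropyBalance.uC r w x) v|
        ∂(localGibbsLaw σ (fun _ => a) (fun _ => u) (fun _ => θ) N (Φ N)) ≤ ENNReal.ofReal ε :=
  -- LANDED p146349 (wave 2, worker S3b2): Theorems/JParityClosureEvenStressEnskogOneBodyDeviationRung0.lean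
  Summit.AtomisticToContinuum.HydrodynamicLimit.Theorems.EvenStressEnskog.stub_oneBodyDeviationRung0

/-- **S3b3 · ASSEMBLY: rung-0 velocity equilibration from the pointwise deviation (closable now, L)** — `η₀ := 1` (any
positive number: at rung 0 the cutoff `k` only needs to be bounded on `[0, ∞)`, which `k = 0` on `[η₀, ∞)` + continuity
give), `r₀ := 1/2`, `σ₀ :=` the minimum of the hypotheses' thresholds.  Steps: (1) `|oneBodyStat − oneBodyPred|(z) ≤
C_χ C_k ∫₀^τ ∫ |D_F(Φ_s z, x)| dx ds` on the good set (linearity of the `s`- and `x`-integrals: the integrands are bounded by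
`C(ρ_r + c·e_r)`, `e_r ≤ (3/πr³) E(z)/(N+1)` conserved along good orbits — the pattern of `integrableOn_oneBodyStat_flow`
for the general growth bound); (2) Markov in `∫⁻` form on the measurable good-set modification of the flow
(`measurable_piecewise_flow_torus`, pattern of `measure_lt_abs_setIntegral_flow_le_of_l1`); (3) Tonelli and flow invariance
`lintegral_comp_flow_localGibbsLaw_const`: `E ∫₀^τ∫|D(Φ_s ·, x)| = τ · E ∫ |D(·, x)| dx`; (4) `E ∫ |D_N(·,x)| dx → 0` by Tonelli
in `(w, x)` (joint measurability: `measurable_oneBodyStatIntegrand_prod` / `…Pred…` with `χ = k = 1`) and dominated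
convergence over the compact torus, the pointwise limit being the deviation hypothesis and the majorant
`C(2·3/(πr³) + c (3/(πr³)) K)` coming from the moment bounds of S3b1. [folklore] -/
def Stubs.stub_velocityEquilibrationRung0_of_deviation : Prop :=
  Rung0LocalStatistics → OneBodyDeviationRung0 → Stubs.stub_velocityEquilibrationRung0

theorem stub_velocityEquilibrationRung0_of_deviation :
    (∀ (a θ : ℝ) (u : V3), 0 < a → 0 < θ → ∃ σ₀ : ℝ, 0 < σ₀ ∧ ∀ σ : ℝ, 0 < σ → σ < σ₀ →
    ∀ Φ : (N : ℕ) → HardSphereFlow (Torus.geometry (Fin 3)) (hsDiameter σ N) (N + 1),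
    (∀ N, IsProbabilityMeasure (localGibbsLaw σ (fun _ => a) (fun _ => u) (fun _ => θ) N (Φ N))) ∧
    (∃ K : ℝ, ∀ N : ℕ,
      ∫⁻ w, ENNReal.ofReal (((N + 1 : ℕ) : ℝ)⁻¹ * ∑ i, ‖(w i).2‖ ^ 2)
          ∂(localGibbsLaw σ (fun _ => a) (fun _ => u) (fun _ => θ) N (Φ N)) ≤ ENNReal.ofReal K ∧
      ∫⁻ w, ENNReal.ofReal ((((N + 1 : ℕ) : ℝ)⁻¹ * ∑ i, ‖(w i).2‖ ^ 2) ^ 2)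
          ∂(localGibbsLaw σ (fun _ => a) (fun _ => u) (fun _ => θ) N (Φ N)) ≤ ENNReal.ofReal K) ∧
    ∀ r : ℝ, 0 < r → r < 1 / 2 → ∀ x : T3,
      Tendsto (fun N : ℕ => ∫⁻ w, ENNReal.ofReal ((mollDensity r w x - 1) ^ 2)
        ∂(localGibbsLaw σ (fun _ => a) (fun _ => u) (fun _ => θ) N (Φ N))) atTop (𝓝 0) ∧
      (∀ G : V3 → ℝ, Continuous G → (∃ C : ℝ, ∀ v, |G v| ≤ C * (1 + ‖v‖ ^ 2)) →
        Tendsto (fun N : ℕ => ∫⁻ w, ENNReal.ofReal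
            (((∫ q, coneKernel r q.1 x * G q.2 ∂(empiricalMeasure w)) -
              mollDensity r w x * ∫ v, G v ∂(gaussMeasure u θ)) ^ 2)
          ∂(localGibbsLaw σ (fun _ => a) (fun _ => u) (fun _ => θ) N (Φ N))) atTop (𝓝 0)) ∧
      ∀ ι : ℝ, 0 < ι →
        Tendsto (fun N : ℕ => localGibbsLaw σ (fun _ => a) (fun _ => u) (fun _ => θ) N (Φ N)
          {w | ι ≤ |mollDensity r w x - 1| + ‖KineticEntropyBalance.uC r w x - u‖ +
            |mollTemperature r w x - θ|}) atTop (𝓝 0)) →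
    (∀ (a θ : ℝ) (u : V3), 0 < a → 0 < θ → ∃ σ₀ : ℝ, 0 < σ₀ ∧ ∀ σ : ℝ, 0 < σ → σ < σ₀ →
    ∀ Φ : (N : ℕ) → HardSphereFlow (Torus.geometry (Fin 3)) (hsDiameter σ N) (N + 1),
    ∀ F : V3 × V3 × ℝ → ℝ, Continuous F →
    (∃ C : ℝ, ∀ q, |F q| ≤ C * (1 + ‖q.1‖ ^ 2 + ‖q.2.1‖ ^ 2 + |q.2.2|)) →
    ∀ r : ℝ, 0 < r → r < 1 / 2 → ∀ x : T3, ∀ ε : ℝ, 0 < ε → ∃ N₀ : ℕ, ∀ N : ℕ, N₀ ≤ N →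
      ∫⁻ w, ENNReal.ofReal
          |(∫ q, coneKernel r q.1 x *
                F (q.2, KineticEntropyBalance.uC r w x, mollTemperature r w x) ∂(empiricalMeasure w)) -
            mollDensity r w x *
              ∫ v, F (v, KineticEntropyBalance.uC r w x, mollTemperature r w x) *
                localMaxwellian 1 (mollTemperature r w x) (KineticEntropyBalance.uC r w x) v|
        ∂(localGibbsLaw σ (fun _ => a) (fun _ => u) (fun _ => θ) N (Φ N)) ≤ ENNReal.ofReal ε) →
    ∃ η₀ : ℝ, 0 < η₀ ∧ ∀ (a θ : ℝ) (u : V3), 0 < a → 0 < θ → ∃ σ₀ : ℝ, 0 < σ₀ ∧ ∀ σ : ℝ, 0 < σ → σ < σ₀ →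
    ∀ Φ : (N : ℕ) → HardSphereFlow (Torus.geometry (Fin 3)) (hsDiameter σ N) (N + 1),
    ∀ τ : ℝ, 0 < τ →
    ∀ χ : ℝ × T3 → ℝ, Continuous χ → ∀ k : ℝ → ℝ, Continuous k → (∀ b, η₀ ≤ b → k b = 0) →
    ∀ F : V3 × V3 × ℝ → ℝ, Continuous F →
    (∃ C : ℝ, ∀ q, |F q| ≤ C * (1 + ‖q.1‖ ^ 2 + ‖q.2.1‖ ^ 2 + |q.2.2|)) →
    ∀ η δ : ℝ, 0 < η → 0 < δ → ∃ r₀ : ℝ, 0 < r₀ ∧ ∀ r : ℝ, 0 < r → r < r₀ → ∃ N₀ : ℕ, ∀ N : ℕ, N₀ ≤ N →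
      localGibbsLaw σ (fun _ => a) (fun _ => u) (fun _ => θ) N (Φ N)
        {z | η < |oneBodyStat σ N (Φ N) τ χ k F r z - oneBodyPred σ N (Φ N) τ χ k F r z|}
        ≤ ENNReal.ofReal δ :=
  -- LANDED p149013 (wave 2, worker S3b3): Theorems/JParityClosureEvenStressEnskogVelocityEquilibrationRung0.lean
  Summit.AtomisticToContinuum.HydrodynamicLimit.Theorems.EvenStressEnskog.stub_velocityEquilibrationRung0_of_deviation

/-- **S3b DERIVED** (reshape v2): the registered rung-0 velocity equilibration from its three registered pieces. [folklore] -/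
theorem stub_velocityEquilibrationRung0 :
    ∃ η₀ : ℝ, 0 < η₀ ∧ ∀ (a θ : ℝ) (u : V3), 0 < a → 0 < θ → ∃ σ₀ : ℝ, 0 < σ₀ ∧ ∀ σ : ℝ, 0 < σ → σ < σ₀ →
    ∀ Φ : (N : ℕ) → HardSphereFlow (Torus.geometry (Fin 3)) (hsDiameter σ N) (N + 1),
    ∀ τ : ℝ, 0 < τ →
    ∀ χ : ℝ × T3 → ℝ, Continuous χ → ∀ k : ℝ → ℝ, Continuous k → (∀ b, η₀ ≤ b → k b = 0) →
    ∀ F : V3 × V3 × ℝ → ℝ, Continuous F →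
    (∃ C : ℝ, ∀ q, |F q| ≤ C * (1 + ‖q.1‖ ^ 2 + ‖q.2.1‖ ^ 2 + |q.2.2|)) →
    ∀ η δ : ℝ, 0 < η → 0 < δ → ∃ r₀ : ℝ, 0 < r₀ ∧ ∀ r : ℝ, 0 < r → r < r₀ → ∃ N₀ : ℕ, ∀ N : ℕ, N₀ ≤ N →
      localGibbsLaw σ (fun _ => a) (fun _ => u) (fun _ => θ) N (Φ N)
        {z | η < |oneBodyStat σ N (Φ N) τ χ k F r z - oneBodyPred σ N (Φ N) τ χ k F r z|}
        ≤ ENNReal.ofReal δ :=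
  stub_velocityEquilibrationRung0_of_deviation stub_rung0LocalStatistics
    (stub_oneBodyDeviationRung0 stub_rung0LocalStatistics)

/-! ### S3c, reshape v3 (lead c7, after the wave-2 audit `KineticSlavingAudit.md`, worker S3c): the lever is
`stub-misstated` as registered in v1/v2 — `KineticHalf` does not supply (A) velocity-moment tightness of the empirical collision
measure (h4) nor (C) mesoscale compactness of the window laws (h6); with the corrected antecedent `KineticAprioriPreShock` it is
provable-in-principle along ParityInBand (i)–(ii) but XL, through the typed plan `KineticSlavingPlan.lean` (published as
`Lines/preshock-kinetic-slaving-S3cPlan.lean`): I₁ Dirac-limit continuity (M, LANDED p147678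
`tendsto_integral_mul_localMaxwellian_nhdsWithin_zero`), I₂ free collisional balance (M) = S3c-a, I₃ diagonal parity rigidity (L) =
S3c-b, I₄ kinetic core for bounded tests (XL) + I₅ second-moment upgrade (L) = S3c-c.  h1 (junk Maxwellian at θ_r = 0) and h2
(mixture vs pointwise) are harmless; the measure-level Metropolis fold of I₄(iv) is LANDED p148656 (`…KineticSlavingMetropolisFold.lean`). -/

/-- **S3c-a · FREE COLLISIONAL BALANCE IN `K_N` UNITS (closable now, M)** — `FreeCollisionalBalanceKN`.  Leans on:
`empiricalEnskogIdentity_proof` (Theorems/JParityClosureEmpiricalEnskogIdentity*.lean), `collisionSum` (EvenCollisionTubeFunctional:144;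
`collisionTimes ∩ Icc 0 τ` vs the identity's `Ioc 0 τ` — hence `0 ∉ collisionTimes`), `reflectVel_smul` / `reflectVel_reflectVel`,
energy conservation on good orbits (`HardSphereFlow.configEnergy_flow`), `integral_dirac` on the empirical measure, smooth `b` on the
compact torus has bounded gradient. [folklore] -/
def Stubs.stub_freeCollisionalBalanceKN : Prop := FreeCollisionalBalanceKN

theorem stub_freeCollisionalBalanceKN :
  ∀ (a : ℝ → ℝ), ContDiff ℝ 1 a → ∀ (b : T3 → ℝ), Literature.Analysis.FunctionSpaces.Torus.IsSmooth b →
  ∀ (c : V3 → ℝ) (Cc : ℝ), (∀ v, |c v| ≤ Cc) → ∀ τ : ℝ, 0 < τ →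
  ∃ C : ℝ, ∀ σ : ℝ, 0 < σ → ∀ (N : ℕ) (Φ : HardSphereFlow (Torus.geometry (Fin 3)) (hsDiameter σ N) (N + 1)),
  ∀ z ∈ Φ.good, (0 : ℝ) ∉ collisionTimes (Torus.geometry (Fin 3)) (hsDiameter σ N) (fun s => Φ.flow s z) →
  ∀ r : ℝ,
    |collisionSum σ N Φ τ (fun p => a p.1 * b p.2) (fun _ => 1)
        (fun q => c (reflectVel q.1 (q.2.1, q.2.2)).1 - c q.2.1) r z|
      ≤ hsDiameter σ N * C * (1 + ((N : ℝ) + 1)⁻¹ * ∑ i, ‖(z i).2‖ ^ 2) :=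
  -- LANDED p151581 (wave 3, worker S3c-a): Theorems/JParityClosureEvenStressEnskogFreeCollisionalBalanceKN.lean
  Summit.AtomisticToContinuum.HydrodynamicLimit.Theorems.EvenStressEnskog.stub_freeCollisionalBalanceKN

/-- **S3c-b · DIAGONAL PARITY RIGIDITY (L, moderate risk)** — `DiagonalParityRigidity`.  Leans on: the internals of
`parityRigidity_proof` (Theorems/JParityClosureParityRigidity{,GaussDiff,Invariance,Phase}.lean: `map_collide_prod_eq_of_ae_rnDeriv`,
`ae_tendsto_lintegral_exp_div`, `charFun_mul_eq_of_ae`, `dirac_or_maxwellian_of_collision_invariant`), `Φ(y) = y(1 − e^{−y}) ≥ ½e^{−y}`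
on `{y < −1}` (uniform integrability of `e^{−F_n}`), S3a-type second-moment upgrade.  Alternative making it unnecessary (planner):
re-type `OddContactSymmetry` with `∃ ϑ₀ ∀ ϑ < ϑ₀` before `∀ η δ`. [folklore] -/
def Stubs.stub_diagonalParityRigidity : Prop := DiagonalParityRigidity

/-- **S3c-b' · DIAGONAL COLLISION INVARIANCE (the registered remainder of S3c-b after wave 3; L–XL, risky)** —
`DiagonalCollisionInvariance`.  Leans on: the four LANDED wave-3 files `…DiagonalParityRigidity{Reduction,Defect,Energy,Identification}.lean`
(p152253 p152891 p153152 p154051) and the worker's plan `work/stubs/DiagonalParityRigidity-PLAN.md` / STATUS (energy route §2: the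
√β-weighted commutation estimate, weak convergence of √β_ω ν_n, Fatou / measurable selection in ω, and the de-weighting estimate (E∞) or
its tight version (E-tight)). [folklore] -/
def Stubs.stub_diagonalCollisionInvariance : Prop := DiagonalCollisionInvariance

theorem stub_diagonalCollisionInvariance :
  ∀ (ms : ℕ → Measure V3) (m : Measure V3) (ϑs : ℕ → ℝ),
    (∀ n, IsProbabilityMeasure (ms n)) → IsProbabilityMeasure m →
    (∀ n, 0 < ϑs n) → Tendsto ϑs atTop (𝓝 0) →
    (∀ n, Integrable (fun v : V3 => ‖v‖ ^ 2) (ms n)) → Integrable (fun v : V3 => ‖v‖ ^ 2) m →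
    (∀ G : V3 → ℝ, Continuous G → (∃ C : ℝ, ∀ v, |G v| ≤ C * (1 + ‖v‖ ^ 2)) →
      Tendsto (fun n => ∫ v, G v ∂(ms n)) atTop (𝓝 (∫ v, G v ∂m))) →
    (let h : ℕ → V3 → ℝ := fun n v => ∫ v', localMaxwellian 1 (ϑs n ^ 2) v v' ∂(ms n)
     let F : ℕ → Metric.sphere (0 : V3) 1 → V3 × V3 → ℝ := fun n ω p =>
       Real.log (h n p.1) + Real.log (h n p.2) - Real.log (h n (collide ω p).1) -
         Real.log (h n (collide ω p).2)
     Tendsto (fun n => ∫⁻ p, ∫⁻ ω, ENNReal.ofReal (hardSphereKernel (p.2, p.1) ω *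
        (F n ω p * (1 - Real.exp (-F n ω p)))) ∂sphereMeasure ∂((ms n).prod (ms n))) atTop (𝓝 0)) →
    ∀ᵐ ω ∂(sphereMeasure : Measure (Metric.sphere (0 : V3) 1)), (m.prod m).map (collide ω) = m.prod m := by
  sorry

/-- **S3c-b DERIVED** (reshape v4): diagonal parity rigidity from the registered diagonal collision invariance by the LANDED
law-independent endgame `stub_diagonalParityRigidity_of_ae_map_collide_eq` (p152253: `charFun_mul_eq_of_ae` +
`dirac_or_maxwellian_of_collision_invariant`). [folklore] -/
theorem stub_diagonalParityRigidity :
  ∀ (ms : ℕ → Measure V3) (m : Measure V3) (ϑs : ℕ → ℝ),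
    (∀ n, IsProbabilityMeasure (ms n)) → IsProbabilityMeasure m →
    (∀ n, 0 < ϑs n) → Tendsto ϑs atTop (𝓝 0) →
    (∀ n, Integrable (fun v : V3 => ‖v‖ ^ 2) (ms n)) → Integrable (fun v : V3 => ‖v‖ ^ 2) m →
    (∀ G : V3 → ℝ, Continuous G → (∃ C : ℝ, ∀ v, |G v| ≤ C * (1 + ‖v‖ ^ 2)) →
      Tendsto (fun n => ∫ v, G v ∂(ms n)) atTop (𝓝 (∫ v, G v ∂m))) →
    (let h : ℕ → V3 → ℝ := fun n v => ∫ v', localMaxwellian 1 (ϑs n ^ 2) v v' ∂(ms n)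
     let F : ℕ → Metric.sphere (0 : V3) 1 → V3 × V3 → ℝ := fun n ω p =>
       Real.log (h n p.1) + Real.log (h n p.2) - Real.log (h n (collide ω p).1) -
         Real.log (h n (collide ω p).2)
     Tendsto (fun n => ∫⁻ p, ∫⁻ ω, ENNReal.ofReal (hardSphereKernel (p.2, p.1) ω *
        (F n ω p * (1 - Real.exp (-F n ω p)))) ∂sphereMeasure ∂((ms n).prod (ms n))) atTop (𝓝 0)) →
    (∃ u : V3, m = Measure.dirac u) ∨
      (∃ θ : ℝ, ∃ u : V3, 0 < θ ∧
        m = (volume : Measure V3).withDensity (fun v => ENNReal.ofReal (localMaxwellian 1 θ u v))) :=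
  Summit.AtomisticToContinuum.HydrodynamicLimit.Theorems.EvenStressEnskog.stub_diagonalParityRigidity_of_ae_map_collide_eq
    stub_diagonalCollisionInvariance

/-- **S3c-c · THE KINETIC CORE FROM ITS TOOLS (XL; = plan I₄ + I₅, I₁ landed)** — given the free balance (S3c-a), diagonal rigidity
(S3c-b), the quadratic-test tool (S3a, landed) and the rung-0 instance (S3b, landed; logically idle, kept for the identification of
constants), the kinetic half BY NAME and the two a-priori inputs BY NAME force pre-shock one-body velocity equilibration.
Architecture (audit §h3, plan I₄): tagged random Young-measure limits of (one-body space–time empirical measure, normalised collision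
measure) — tight by energy + `CollisionTightness`, weak in velocity by (A); trivial fibres by (C); stagewise `OddContactSymmetry` ⇒
Metropolis-odd statistic → 0 ⇒ `J`-invariance (p139072) ; free balance + (A) ⇒ balanced `κ̄`; H-fold (p148656) ⇒ production → 0 on
`supp κ̄`; `RateFloor` ⇒ thickness; S3c-b ⇒ Dirac or Maxwellian fibres; I₁ (p147678) + `continuousAt_integral_mul_localMaxwellian`
(p140467) + `KineticEnergyTails` ⇒ the defect vanishes for bounded tests; truncation + `KineticEnergyTails` + S3a ⇒ quadratic growth
(I₅).  `LocalSecondLaw` unused.  Size XL (weeks): the honest remaining kinetic work of the route (shared with 13088 / 17608), a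
PROMOTE-STUB candidate. [folklore] -/
def Stubs.stub_kineticCoreOfTools : Prop :=
  FreeCollisionalBalanceKN → DiagonalParityRigidity → Stubs.stub_quadraticTestConvergence →
    Stubs.stub_velocityEquilibrationRung0 → KineticHalf → KineticAprioriPreShock → VelocityEquilibrationPreShock

theorem stub_kineticCoreOfTools :
    FreeCollisionalBalanceKN → DiagonalParityRigidity → Stubs.stub_quadraticTestConvergence →
      Stubs.stub_velocityEquilibrationRung0 → KineticHalf → KineticAprioriPreShock → VelocityEquilibrationPreShock := by
  sorry

/-- **S3c CORRECTED, DERIVED** (reshape v3): the lever with its honest antecedents, from the three registered pieces and the landed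
tools. [folklore] -/
def Stubs.stub_kineticSlaving : Prop := KineticHalf → KineticAprioriPreShock → VelocityEquilibrationPreShock

theorem kineticSlaving_of_tools (hI2 : Stubs.stub_freeCollisionalBalanceKN) (hI3 : Stubs.stub_diagonalParityRigidity)
    (hcore : Stubs.stub_kineticCoreOfTools) : Stubs.stub_kineticSlaving :=
  hcore hI2 hI3 stub_quadraticTestConvergence stub_velocityEquilibrationRung0

/-- **S45 · THE KINETIC INPUTS (BY CITATION; NOT A TARGET OF THIS LINE)** — `KineticHalf ∧ KineticAprioriPreShock`: the route
items 17722 / 13080 / 13081 / 13082 / 13085 / 13087 and 13354 BY NAME, plus the unfiled a-priori input `MesoscaleCompactnessPreShock`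
(reshape v3 merges the former S4 `stub_kineticHalf` with the new antecedent so that the registered total stays 7).  Closes by
`exact ⟨⟨oddContactSymmetry_proof, …⟩, ⟨LimitCollisionMeasure.collisionTightness_proof, mesoscaleCompactnessPreShock_proof⟩⟩` when those
exist; until then a stub-worker's correct answer is `blocked-on: stmt-AtomisticToContinuum-17722` (+ 13354; Meso unfiled).  Audit of
the six KineticHalf items: `KineticHalfAudit-c7.md` (no conjunct false-as-filed; 13080/13081 carry standing `misstated` verdicts). [folklore] -/
def Stubs.stub_kineticInputs : Prop := KineticHalf ∧ KineticAprioriPreShock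

theorem stub_kineticInputs : KineticHalf ∧ KineticAprioriPreShock := by
  sorry

/-! ## §4 The composition (kernel-checked, sorry-free) -/

/-- **The pre-shock crux from the core, the lever and the kinetic inputs** — planner-facing: this is the glue of the post-R
decomposition `EvenStressEnskogPreShock ⇐ ContactEvenPreShock ∧ VelocityEquilibrationPreShock` (children) with
`VelocityEquilibrationPreShock ⇐ KineticHalf ∧ KineticAprioriPreShock` (the corrected lever). [folklore] -/
theorem evenStressEnskogPreShock_of_core_of_slaving (h2 : ContactEvenPreShock)
    (h3 : KineticHalf → KineticAprioriPreShock → VelocityEquilibrationPreShock) (h45 : KineticHalf ∧ KineticAprioriPreShock) :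
    EvenStressEnskogPreShock :=
  evenStressEnskogPreShock_of_sides h2 (enskogSidePreShock_of_velocityEquilibration (h3 h45.1 h45.2))

/-- **`EvenStressEnskog` from the registered stubs** (lead c7 reshape v4; S3a, S3b1–S3b3, S3c-a and the S3c-b reduction are LANDED and enter as theorems):
`h1 (evenStressEnskogPreShock_of_core_of_slaving h2 (kineticSlaving_of_tools S3c-a (reduction hML) hcore) h45)` — the ONE theorem of this file
concluding the crux decl by name with stub hypotheses. [folklore] -/
theorem EvenStressEnskog_of
    (h1 : Stubs.stub_frameGap) (h2 : Stubs.stub_contactEvenPreShock)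
    (hML : Stubs.stub_diagonalCollisionInvariance)
    (hcore : Stubs.stub_kineticCoreOfTools) (h45 : Stubs.stub_kineticInputs) : EvenStressEnskog :=
  h1 (evenStressEnskogPreShock_of_core_of_slaving h2
    (kineticSlaving_of_tools stub_freeCollisionalBalanceKN
      (Summit.AtomisticToContinuum.HydrodynamicLimit.Theorems.EvenStressEnskog.stub_diagonalParityRigidity_of_ae_map_collide_eq hML)
      hcore) h45)

/-- **The skeleton IS the crux proof modulo the registered stubs** (D-0027 §3.3 shape). [folklore] -/
theorem EvenStressEnskog_proof : EvenStressEnskog :=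
  EvenStressEnskog_of stub_frameGap stub_contactEvenPreShock stub_diagonalCollisionInvariance
    stub_kineticCoreOfTools stub_kineticInputs

/-! ## §4b Rung 0 of both children of the split (LANDED, lead c7: p140225 `…Rung0Sides`, p140441 `…PreShockRung0Frame`) -/

/-- The contact side AT RUNG 0 (constant profiles, untied: every flow family, every `τ > 0`) — the rung 0 of the crux child
`ContactEvenPreShock`. [folklore] -/
def ContactEvenRung0 : Prop :=
  ∃ η₀ : ℝ, 0 < η₀ ∧ ∀ (a θ : ℝ) (u : V3), 0 < a → 0 < θ → ∃ σ₀ : ℝ, 0 < σ₀ ∧ ∀ σ : ℝ, 0 < σ → σ < σ₀ →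
    ∀ Φ : (N : ℕ) → HardSphereFlow (Torus.geometry (Fin 3)) (hsDiameter σ N) (N + 1), ∀ τ : ℝ, 0 < τ →
    ∀ χ : ℝ × T3 → ℝ, Continuous χ → ∀ g : ℝ → ℝ, Continuous g → (∀ a, η₀ ≤ a → g a = 0) →
    ∀ k l : Fin 3,
    ∀ η δ : ℝ, 0 < η → 0 < δ → ∃ r₀ : ℝ, 0 < r₀ ∧ ∀ r : ℝ, 0 < r → r < r₀ → ∃ N₀ : ℕ, ∀ N : ℕ, N₀ ≤ N →
      localGibbsLaw σ (fun _ => a) (fun _ => u) (fun _ => θ) N (Φ N)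
        {z | η < |collisionSum σ N (Φ N) τ χ g (evenMark k l) r z - contactPredM σ N (Φ N) τ χ g (evenMark k l) r z|}
        ≤ ENNReal.ofReal δ

/-- **The pre-shock frame is free at rung 0**: the support child pre-shock gives the registered rung-0 stub S3b verbatim
(constant classical solution + `t = 0` LLN of the homogeneous Gibbs laws; LANDED p140441). [folklore] -/
theorem velocityEquilibrationRung0_of_preShock (h : VelocityEquilibrationPreShock) :
    Stubs.stub_velocityEquilibrationRung0 :=
  Summit.AtomisticToContinuum.HydrodynamicLimit.Theorems.EvenStressEnskog.velocityEquilibrationRung0_of_velocityEquilibrationPreShock h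

/-- Likewise the crux child pre-shock gives the contact side at rung 0 (LANDED p140441). [folklore] -/
theorem contactEvenRung0_of_preShock (h : ContactEvenPreShock) : ContactEvenRung0 :=
  Summit.AtomisticToContinuum.HydrodynamicLimit.Theorems.EvenStressEnskog.contactSideRung0_of_contactEvenPreShock h

/- **(L1)₀ ⇒ the contact side at rung 0** — the rung 0 of the crux child follows from the registered rung-0 stub S3b alone
(Enskog side at rung 0 by the exact identification identity, then the union bound with the UNCONDITIONAL crux at rung 0
`evenStressEnskog_rung0`, p121729; LANDED p140225 as
`Summit.AtomisticToContinuum.HydrodynamicLimit.Theorems.EvenStressEnskog.contactSideRung0_of_velocityEquilibrationRung0 :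
Stubs.stub_velocityEquilibrationRung0 → ContactEvenRung0`).  So the moment S3b lands, both children are closed at rung 0.
(The one-line wrapper `contactEvenRung0_of_velocityEquilibrationRung0 h := contactSideRung0_of_velocityEquilibrationRung0 h` is
re-enabled together with the import of `…Rung0Sides` once the farm has built that module; the unconditional rung 0 of the crux itself,
`evenStressEnskog_rung0`, is `#check`ed in §5.) -/

/-! ## §5 Checked against the landed Negative lemmas (imported above) -/

/- `preShock_of_crux` (§2) shows the filed crux implies the pre-shock form outright, so S1 smuggles in no strengthening:
S1 ∘ `preShock_of_crux` is an endomorphism of `EvenStressEnskog` (not stated as a theorem, so that exactly ONE theorem of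
this file with stub hypotheses — `EvenStressEnskog_of` — concludes the crux decl by name). -/

/- Limit-order hygiene (Disproof §9, `Negative/SwappedOrderTrivial`): every statement of this file fixes `r` while
`N → ∞` (`∃ r₀ ∀ r < r₀ ∃ N₀ ∀ N ≥ N₀`); the swapped order is the landed junk-true `evenStressEnskog_swappedOrder`
(`#check`ed here so that no reshaped stub ever adopts it); the `∀ τ` texture witness of §12 is
`pairFunctionalP_two_stream` (lives only inside S1). -/
example : True := by
  have _h0 := @preShock_of_crux
  have _h00 := @evenStressEnskog_rung0
  have _h9 := @evenStressEnskog_swappedOrder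
  have _h12 := @pairFunctionalP_two_stream
  trivial

end Summit.AtomisticToContinuum.HydrodynamicLimit.Cruxes.EvenStressEnskog.PreshockKineticSlaving

end
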